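import Summits.QuantumAdvantage.QuantumAdvantage.Theorems.CubicForrelationNearExactIsExactCubicFormR4ZHyper
import Summits.QuantumAdvantage.QuantumAdvantage.Theorems.CubicForrelationNearExactIsExactCubicFormR4ZFlat
import Summits.QuantumAdvantage.QuantumAdvantage.Theorems.CubicForrelationNearExactIsExactCubicFormR4ZCoset
import Summits.QuantumAdvantage.QuantumAdvantage.Theorems.CubicForrelationNearExactIsExactCubicFormR4CellForms
import Summits.QuantumAdvantage.QuantumAdvantage.Theorems.CubicForrelationNearExactIsExactCubicFormR4TBudget
import Summits.QuantumAdvantage.QuantumAdvantage.Theorems.CubicForrelationNearExactIsExactCubicFormR4ZLeaf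

/-!
# Crux `CubicForrelation.NearExactIsExact` (stmt-QuantumAdvantage-14043) — E1280-even, R4 branch: the descendant `0` (`HZ`) REDUCED TO ITS
  LEAF

Certificate seat `b2b-cforr-cert` (gen 43).  HONEST FRAMING: kernel-checked reduction (standard axioms).  `tpw_R4_zero_of_leaf HLEAF` is
LITERALLY the hypothesis `HZ` of `tpw_HR4_of_branches` (…CubicFormR4PartnerAssembly), where `HLEAF` is the d-level leaf statement: a cubic
form `d` on `𝔽₂^{5+7}` with a pairing partner, `d(y_a,·,·) = v₀v₁ + v₂v₃`, `d|_{z×z×z} = 0`, `d(v_t,z_j,z_k) = a_t Ξ_{jk}` (`a ≠ 0`) and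
`d(v_t,v_{t'},z_j) = ω_{tt'}E_j + a_tM_{t'j} + a_{t'}M_{tj}` is impossible — E1280-HANDPROOFS §2.4 (normal form `y∧ω + v₀∧(Ξ + Σ v_t∧y_t)`,
cores …TwelvePartnerR4LeafZ); `HLEAF` is …CubicFormR4ZLeaf `tq0_leaf`, so `tpw_R4_zero : HZ` is unconditional; `HR4` follows with `HL 1`, `HL 2`
(…CubicFormR4LevelOne/Two) by `tpw_HR4_of_branches`; `θ₁₂ = 57/64` still needs the R2 half landed.  NOT summit progress.
THE REDUCTION (R4-PARTNER §3–4 reorganised; no dimension counts, no enumeration): all cells are quadratic (…CubicFormR4ZTools); the budget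
gives three zero cells `z₁, z₂, z₃ ∈ Z₁₀` (…CubicFormR4ZBudget `tq0_budget_three`); the forms `β_v` are affine in `v`
(`tc5_second_rho`), so by …CubicFormR4ZAffine/…CubicFormR4ZCoset `β_v = c_x(v)·X ⊕ c_y(v)·Y` with `X = β_{z₁⊕e_i}`, `Y = β_{z₁⊕e_j}`;
if `X = Y = 0` every vector is radical for all forms and the pigeonhole (★) (`tq0_pigeon`, `128 > 8`) ends it; if exactly one of
`X, Y, X⊕Y` vanishes we are in the hyperplane case (…CubicFormR4ZHyper, which consumes `HLEAF`); otherwise in the two-flat case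
(…CubicFormR4ZFlat).

References: this seat lineage (g37 R4-PARTNER §3–4, g39 HANDPROOFS §2.4, g42 dispatch, g43 LEAN-GEN43).  Axioms: the standard three.
-/

set_option linter.dupNamespace false -- D-0017: single-problem summit ⇒ `QuantumAdvantage.QuantumAdvantage` by design

namespace Summit.QuantumAdvantage.QuantumAdvantage.Theorems.CubicForrelation.NearExactIsExact

open Finset
open Literature.Computability.QuantumComplexity
open Literature.Computability.QuantumComplexity.BuzetChailloux (bxor zeroVec bxor_comm bxor_self bxor_zeroVec zeroVec_bxor
  bxor_bxor_cancel_left)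

/-- **Descendant `0` reduced to its leaf** — `tpw_R4_zero_of_leaf HLEAF` is literally hypothesis `HZ` of `tpw_HR4_of_branches`.
See the module docstring. [this work] -/
theorem tpw_R4_zero_of_leaf (HLEAF : (∀ (c d : Fin (5 + 7) → Fin (5 + 7) → Fin (5 + 7) → ZMod 2),
      (∀ p j k, c p k j = c p j k) → (∀ p j k, c j p k = c p j k) → (∀ p j, c p j j = 0) →
      (∀ φ j k, d φ k j = d φ j k) → (∀ φ j k, d j φ k = d φ j k) → (∀ φ j, d φ j j = 0) →
      (∀ p φ, (∑ j, ∑ k, (if j < k then c p j k * d φ j k else 0)) = if p = φ then 1 else 0) →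
      (∀ j k, d (Fin.castAdd 7 (0 : Fin 5)) j k =
        (if (j = Fin.castAdd 7 (1 : Fin 5) ∧ k = Fin.castAdd 7 (2 : Fin 5)) ∨ (j = Fin.castAdd 7 (2 : Fin 5) ∧ k = Fin.castAdd 7 (1 : Fin 5)) then 1 else 0) +
        (if (j = Fin.castAdd 7 (3 : Fin 5) ∧ k = Fin.castAdd 7 (4 : Fin 5)) ∨ (j = Fin.castAdd 7 (4 : Fin 5) ∧ k = Fin.castAdd 7 (3 : Fin 5)) then 1 else 0)) →
      (∀ σ τ υ : Fin 7, d (Fin.natAdd 5 σ) (Fin.natAdd 5 τ) (Fin.natAdd 5 υ) = 0) →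
      ∀ (a : Fin 4 → ZMod 2), (∃ t, a t = 1) →
      ∀ (Ξ : Fin 7 → Fin 7 → ZMod 2), (∀ j k, Ξ k j = Ξ j k) → (∀ j, Ξ j j = 0) →
      (∀ (t : Fin 4) (j k : Fin 7), d (Fin.castAdd 7 t.succ) (Fin.natAdd 5 j) (Fin.natAdd 5 k) = a t * Ξ j k) →
      ∀ (E : Fin 7 → ZMod 2) (M : Fin 4 → Fin 7 → ZMod 2),
      (∀ (t t' : Fin 4) (j : Fin 7), d (Fin.castAdd 7 t.succ) (Fin.castAdd 7 t'.succ) (Fin.natAdd 5 j) =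
        ((if (t = 0 ∧ t' = 1) ∨ (t = 1 ∧ t' = 0) then (1 : ZMod 2) else 0) + (if (t = 2 ∧ t' = 3) ∨ (t = 3 ∧ t' = 2) then (1 : ZMod 2) else 0)) * E j + a t * M t' j + a t' * M t j) → False)) :
    ∀ (κ : (Fin (5 + 7) → Bool) → Bool), IsDegLeFun 3 κ →
    ∀ (c d : Fin (5 + 7) → Fin (5 + 7) → Fin (5 + 7) → ZMod 2),
    (∀ p j k, c p k j = c p j k) → (∀ p j k, c j p k = c p j k) → (∀ p j, c p j j = 0) →
    (∀ φ j k, d φ k j = d φ j k) → (∀ φ j k, d j φ k = d φ j k) → (∀ φ j, d φ j j = 0) →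
    (∀ φ j k, d φ j k =
      if ((((κ zeroVec ^^ κ (bxor zeroVec (fun l => decide (l = k)))) ^^
              (κ (bxor zeroVec (fun l => decide (l = j))) ^^ κ (bxor (bxor zeroVec (fun l => decide (l = j))) (fun l => decide (l = k))))) ^^
            ((κ (bxor zeroVec (fun l => decide (l = φ))) ^^ κ (bxor (bxor zeroVec (fun l => decide (l = φ))) (fun l => decide (l = k)))) ^^
              (κ (bxor (bxor zeroVec (fun l => decide (l = φ))) (fun l => decide (l = j))) ^^
                κ (bxor (bxor (bxor zeroVec (fun l => decide (l = φ))) (fun l => decide (l = j))) (fun l => decide (l = k))))))) = true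
      then 1 else 0) →
    (∀ p φ, (∑ j, ∑ k, (if j < k then c p j k * d φ j k else 0)) = if p = φ then 1 else 0) →
    (∀ y, (κ y ^^ κ (bxor y (fun l => decide (l = Fin.castAdd 7 (0 : Fin 5))))) =
      ((y (Fin.castAdd 7 (1 : Fin 5)) && y (Fin.castAdd 7 (2 : Fin 5))) ^^ (y (Fin.castAdd 7 (3 : Fin 5)) && y (Fin.castAdd 7 (4 : Fin 5))))) →
    (∀ j k, d (Fin.castAdd 7 (0 : Fin 5)) j k =
      (if (j = Fin.castAdd 7 (1 : Fin 5) ∧ k = Fin.castAdd 7 (2 : Fin 5)) ∨ (j = Fin.castAdd 7 (2 : Fin 5) ∧ k = Fin.castAdd 7 (1 : Fin 5)) then 1 else 0) +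
      (if (j = Fin.castAdd 7 (3 : Fin 5) ∧ k = Fin.castAdd 7 (4 : Fin 5)) ∨ (j = Fin.castAdd 7 (4 : Fin 5) ∧ k = Fin.castAdd 7 (3 : Fin 5)) then 1 else 0)) →
    #(univ.filter fun y : Fin (5 + 7) → Bool => κ y = true) < 1280 →
    (∀ σ τ υ : Fin 7, d (Fin.natAdd 5 σ) (Fin.natAdd 5 τ) (Fin.natAdd 5 υ) = 0) → False := by
  classical
  intro κ hκ c d hcs hcc hcd hds hdc hdd hd hpair hD hF hlt hzzz
  -- budget, quadratic cells, weight levels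
  have hbudget : #(univ.filter fun s : Fin 7 → Bool => κ (Fin.append (Matrix.vecCons false ![false, false, false, false]) s) = true) + #(univ.filter fun s : Fin 7 → Bool => κ (Fin.append (Matrix.vecCons false ![false, false, false, true]) s) = true) + #(univ.filter fun s : Fin 7 → Bool => κ (Fin.append (Matrix.vecCons false ![false, false, true, false]) s) = true) + #(univ.filter fun s : Fin 7 → Bool => κ (Fin.append (Matrix.vecCons false ![false, true, false, false]) s) = true) + #(univ.filter fun s : Fin 7 → Bool => κ (Fin.append (Matrix.vecCons false ![false, true, false, true]) s) = true) + #(univ.filter fun s : Fin 7 → Bool => κ (Fin.append (Matrix.vecCons false ![false, true, true, false]) s) = true) + #(univ.filter fun s : Fin 7 → Bool => κ (Fin.append (Matrix.vecCons false ![true, false, false, false]) s) = true) + #(univ.filter fun s : Fin 7 → Bool => κ (Fin.append (Matrix.vecCons false ![true, false, false, true]) s) = true) + #(univ.filter fun s : Fin 7 → Bool => κ (Fin.append (Matrix.vecCons false ![true, false, true, false]) s) = true) + #(univ.filter fun s : Fin 7 → Bool => κ (Fin.append (Matrix.vecCons false ![true, true, true, true]) s) = true) ≤ 255 := by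
    have hwt := tc5_weight κ hD
    have h128 : (2 : ℕ) ^ 7 = 128 := by norm_num
    rw [h128] at hwt
    omega
  have hq : ∀ (v : Fin 4 → Bool) (u' v' w x : Fin 7 → Bool),
      ((((κ (Fin.append (Matrix.vecCons false v) x) ^^ κ (Fin.append (Matrix.vecCons false v) (bxor x w))) ^^ (κ (Fin.append (Matrix.vecCons false v) (bxor x v')) ^^ κ (Fin.append (Matrix.vecCons false v) (bxor (bxor x v') w)))) ^^
          ((κ (Fin.append (Matrix.vecCons false v) (bxor x u')) ^^ κ (Fin.append (Matrix.vecCons false v) (bxor (bxor x u') w))) ^^ (κ (Fin.append (Matrix.vecCons false v) (bxor (bxor x u') v')) ^^ κ (Fin.append (Matrix.vecCons false v) (bxor (bxor (bxor x u') v') w)))))) = false :=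
    fun v u' v' w x => tq0_cells_quadratic κ hκ d hd hzzz (Matrix.vecCons false v) u' v' w x
  have h32 : ∀ v : Fin 4 → Bool, (∀ s, κ (Fin.append (Matrix.vecCons false v) s) = false) ∨ 32 ≤ #(univ.filter fun s : Fin 7 → Bool => κ (Fin.append (Matrix.vecCons false v) s) = true) :=
    fun v => tq0_weight32 (fun s : Fin 7 → Bool => κ (Fin.append (Matrix.vecCons false v) s)) (hq v)
  have hW0 : ∀ v : Fin 4 → Bool, (∀ s, κ (Fin.append (Matrix.vecCons false v) s) = false) → #(univ.filter fun s : Fin 7 → Bool => κ (Fin.append (Matrix.vecCons false v) s) = true) = 0 := by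
    intro v h; rw [card_eq_zero, filter_eq_empty_iff]; intro s _ hs; rw [h s] at hs; exact Bool.false_ne_true hs
  have hWz : ∀ v : Fin 4 → Bool, #(univ.filter fun s : Fin 7 → Bool => κ (Fin.append (Matrix.vecCons false v) s) = true) = 0 → ∀ s, κ (Fin.append (Matrix.vecCons false v) s) = false := by
    intro v h s
    rw [card_eq_zero, filter_eq_empty_iff] at h
    by_contra hs
    exact h (mem_univ s) (by simpa using hs)
  -- three zero cells
  have hz3 : ∀ p q : Fin 4 → Bool, ∃ z : Fin 4 → Bool, ((z 0 && z 1) ^^ (z 2 && z 3)) = false ∧ z ≠ p ∧ z ≠ q ∧ #(univ.filter fun s : Fin 7 → Bool => κ (Fin.append (Matrix.vecCons false z) s) = true) = 0 := by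
    intro p q
    by_contra hno
    push Not at hno
    exact tq0_budget_three (fun v => #(univ.filter fun s : Fin 7 → Bool => κ (Fin.append (Matrix.vecCons false v) s) = true)) hbudget p q
      (fun v hv hp hq' => (h32 v).elim (fun h0 => absurd (hW0 v h0) (hno v hv hp hq')) id)
  obtain ⟨z₁, -, -, -, hz₁W⟩ := hz3 ![false, false, false, false] ![false, false, false, false]
  obtain ⟨z₂, -, hz₂₁, -, hz₂W⟩ := hz3 z₁ z₁
  obtain ⟨z₃, -, hz₃₁, hz₃₂, hz₃W⟩ := hz3 z₁ z₂
  have hz₁ := hWz z₁ hz₁W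
  have hz₂ := hWz z₂ hz₂W
  have hz₃ := hWz z₃ hz₃W
  -- the forms are affine in the cell index
  have haffine : ∀ (σ k : Fin 7) (v : Fin 4 → Bool), ((κ (Fin.append (Matrix.vecCons false v) zeroVec) ^^ κ (Fin.append (Matrix.vecCons false v) (fun l => decide (l = k)))) ^^ (κ (Fin.append (Matrix.vecCons false v) (fun l => decide (l = σ))) ^^ κ (Fin.append (Matrix.vecCons false v) (bxor (fun l => decide (l = σ)) (fun l => decide (l = k)))))) =
      ((((((κ zeroVec ^^ κ (bxor zeroVec (fun l => decide (l = Fin.natAdd 5 k)))) ^^ (κ (bxor zeroVec (fun l => decide (l = Fin.natAdd 5 σ))) ^^ κ (bxor (bxor zeroVec (fun l => decide (l = Fin.natAdd 5 σ))) (fun l => decide (l = Fin.natAdd 5 k))))) ^^ (v 0 && (((κ zeroVec ^^ κ (bxor zeroVec (fun l => decide (l = Fin.natAdd 5 k)))) ^^ (κ (bxor zeroVec (fun l => decide (l = Fin.natAdd 5 σ))) ^^ κ (bxor (bxor zeroVec (fun l => decide (l = Fin.natAdd 5 σ))) (fun l => decide (l = Fin.natAdd 5 k))))) ^^ ((κ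 (bxor zeroVec (fun l => decide (l = Fin.castAdd 7 (1 : Fin 5)))) ^^ κ (bxor (bxor zeroVec (fun l => decide (l = Fin.castAdd 7 (1 : Fin 5)))) (fun l => decide (l = Fin.natAdd 5 k)))) ^^ (κ (bxor (bxor zeroVec (fun l => decide (l = Fin.castAdd 7 (1 : Fin 5)))) (fun l => decide (l = Fin.natAdd 5 σ))) ^^ κ (bxor (bxor (bxor zeroVec (fun l => decide (l = Fin.castAdd 7 (1 : Fin 5)))) (fun l => decide (l = Fin.natAdd 5 σ))) (fun l => decide (l = Fin.natAdd 5 k)))))))) ^^ (v 1 && (((κ zeroVec ^^ κ (bxor zeroVec (fun l => decide (l = Fin.natAdd 5 k)))) ^^ (κ (bxor zeroVec (fun l => decide (l = Fin.natAdd 5 σ))) ^^ κ (bxor (bxor zeroVec (fun l => decide (l = Fin.natAdd 5 σ))) (fun l => decide (l = Fin.natAdd 5 k))))) ^^ ((κ (bxor zeroVec (fun l => decide (l = Fin.castAdd 7 (2 : Fin 5)))) ^^ κ (bxor (bxor zeroVec (fun l => decide (l = Fin.castAdd 7 (2 : Fin 5)))) (fun l => decide (l = Fin.natAdd 5 k))))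 ^^ (κ (bxor (bxor zeroVec (fun l => decide (l = Fin.castAdd 7 (2 : Fin 5)))) (fun l => decide (l = Fin.natAdd 5 σ))) ^^ κ (bxor (bxor (bxor zeroVec (fun l => decide (l = Fin.castAdd 7 (2 : Fin 5)))) (fun l => decide (l = Fin.natAdd 5 σ))) (fun l => decide (l = Fin.natAdd 5 k)))))))) ^^ (v 2 && (((κ zeroVec ^^ κ (bxor zeroVec (fun l => decide (l = Fin.natAdd 5 k)))) ^^ (κ (bxor zeroVec (fun l => decide (l = Fin.natAdd 5 σ))) ^^ κ (bxor (bxor zeroVec (fun l => decide (l = Fin.natAdd 5 σ))) (fun l => decide (l = Fin.natAdd 5 k))))) ^^ ((κ (bxor zeroVec (fun l => decide (l = Fin.castAdd 7 (3 : Fin 5)))) ^^ κ (bxor (bxor zeroVec (fun l => decide (l = Fin.castAdd 7 (3 : Fin 5)))) (fun l => decide (l = Fin.natAdd 5 k)))) ^^ (κ (bxor (bxor zeroVec (fun l => decide (l = Fin.castAdd 7 (3 : Fin 5)))) (fun l => decide (l = Fin.natAdd 5 σ))) ^^ κ (bxor (bxor (bxor zeroVec (fun l => decide (l = Fin.castAdd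 7 (3 : Fin 5)))) (fun l => decide (l = Fin.natAdd 5 σ))) (fun l => decide (l = Fin.natAdd 5 k)))))))) ^^ (v 3 && (((κ zeroVec ^^ κ (bxor zeroVec (fun l => decide (l = Fin.natAdd 5 k)))) ^^ (κ (bxor zeroVec (fun l => decide (l = Fin.natAdd 5 σ))) ^^ κ (bxor (bxor zeroVec (fun l => decide (l = Fin.natAdd 5 σ))) (fun l => decide (l = Fin.natAdd 5 k))))) ^^ ((κ (bxor zeroVec (fun l => decide (l = Fin.castAdd 7 (4 : Fin 5)))) ^^ κ (bxor (bxor zeroVec (fun l => decide (l = Fin.castAdd 7 (4 : Fin 5)))) (fun l => decide (l = Fin.natAdd 5 k)))) ^^ (κ (bxor (bxor zeroVec (fun l => decide (l = Fin.castAdd 7 (4 : Fin 5)))) (fun l => decide (l = Fin.natAdd 5 σ))) ^^ κ (bxor (bxor (bxor zeroVec (fun l => decide (l = Fin.castAdd 7 (4 : Fin 5)))) (fun l => decide (l = Fin.natAdd 5 σ))) (fun l => decide (l = Fin.natAdd 5 k)))))))) := by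
    intro σ k v
    have h1 := tc5_second_cell κ (Matrix.vecCons false v) zeroVec σ k
    simp only [zeroVec_bxor] at h1
    have h2 := tc5_second_rho κ hκ (Matrix.vecCons false v) σ k
    dsimp only at h2
    have c0 : (Matrix.vecCons false v : Fin 5 → Bool) 0 = false := rfl; have c1 : (Matrix.vecCons false v : Fin 5 → Bool) 1 = v 0 := rfl
    have c2 : (Matrix.vecCons false v : Fin 5 → Bool) 2 = v 1 := rfl; have c3 : (Matrix.vecCons false v : Fin 5 → Bool) 3 = v 2 := rfl
    have c4 : (Matrix.vecCons false v : Fin 5 → Bool) 4 = v 3 := rfl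
    rw [c0, c1, c2, c3, c4, Bool.false_and, Bool.xor_false] at h2
    rw [h1]
    exact h2
  have hA3 : ∀ (j' k' : Fin 7) (a b c : Fin 4 → Bool), ((κ (Fin.append (Matrix.vecCons false (bxor (bxor a b) c)) zeroVec) ^^ κ (Fin.append (Matrix.vecCons false (bxor (bxor a b) c)) (fun l => decide (l = k')))) ^^ (κ (Fin.append (Matrix.vecCons false (bxor (bxor a b) c)) (fun l => decide (l = j'))) ^^ κ (Fin.append (Matrix.vecCons false (bxor (bxor a b) c)) (bxor (fun l => decide (l = j')) (fun l => decide (l = k')))))) =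
      ((((κ (Fin.append (Matrix.vecCons false a) zeroVec) ^^ κ (Fin.append (Matrix.vecCons false a) (fun l => decide (l = k')))) ^^ (κ (Fin.append (Matrix.vecCons false a) (fun l => decide (l = j'))) ^^ κ (Fin.append (Matrix.vecCons false a) (bxor (fun l => decide (l = j')) (fun l => decide (l = k')))))) ^^ ((κ (Fin.append (Matrix.vecCons false b) zeroVec) ^^ κ (Fin.append (Matrix.vecCons false b) (fun l => decide (l = k')))) ^^ (κ (Fin.append (Matrix.vecCons false b) (fun l => decide (l = j'))) ^^ κ (Fin.append (Matrix.vecCons false b) (bxor (fun l => decide (l = j')) (fun l => decide (l = k'))))))) ^^ ((κ (Fin.append (Matrix.vecCons false c) zeroVec) ^^ κ (Fin.append (Matrix.vecCons false c) (fun l => decide (l = k')))) ^^ (κ (Fin.append (Matrix.vecCons false c) (fun l => decide (l = j'))) ^^ κ (Fin.append (Matrix.vecCons false c) (bxor (fun l => decide (l = j')) (fun l => decide (l = k'))))))) := by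
    intro j' k' a b c
    rw [haffine, haffine, haffine, haffine]
    exact tq0_af_three _ _ _ _ _ a b c
  have hAz1 : ∀ j' k' : Fin 7, ((κ (Fin.append (Matrix.vecCons false z₁) zeroVec) ^^ κ (Fin.append (Matrix.vecCons false z₁) (fun l => decide (l = k')))) ^^ (κ (Fin.append (Matrix.vecCons false z₁) (fun l => decide (l = j'))) ^^ κ (Fin.append (Matrix.vecCons false z₁) (bxor (fun l => decide (l = j')) (fun l => decide (l = k')))))) = false := by intro j' k'; rw [hz₁, hz₁, hz₁, hz₁]; rfl
  have hAz2 : ∀ j' k' : Fin 7, ((κ (Fin.append (Matrix.vecCons false z₂) zeroVec) ^^ κ (Fin.append (Matrix.vecCons false z₂) (fun l => decide (l = k')))) ^^ (κ (Fin.append (Matrix.vecCons false z₂) (fun l => decide (l = j'))) ^^ κ (Fin.append (Matrix.vecCons false z₂) (bxor (fun l => decide (l = j')) (fun l => decide (l = k')))))) = false := by intro j' k'; rw [hz₂, hz₂, hz₂, hz₂]; rfl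
  have hAz3 : ∀ j' k' : Fin 7, ((κ (Fin.append (Matrix.vecCons false z₃) zeroVec) ^^ κ (Fin.append (Matrix.vecCons false z₃) (fun l => decide (l = k')))) ^^ (κ (Fin.append (Matrix.vecCons false z₃) (fun l => decide (l = j'))) ^^ κ (Fin.append (Matrix.vecCons false z₃) (bxor (fun l => decide (l = j')) (fun l => decide (l = k')))))) = false := by intro j' k'; rw [hz₃, hz₃, hz₃, hz₃]; rfl
  -- transversal unit vectors for `D = {0, z₁⊕z₂, z₁⊕z₃, z₂⊕z₃}`
  have hne : ∀ x y : Fin 4 → Bool, x ≠ y → (((bxor y x) 0) || ((bxor y x) 1) || ((bxor y x) 2) || ((bxor y x) 3)) = true := by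
    intro x y hxy
    by_contra h
    apply hxy
    rw [Bool.not_eq_true] at h
    simp only [Bool.or_eq_false_iff] at h
    funext t
    have ht : t = 0 ∨ t = 1 ∨ t = 2 ∨ t = 3 := by fin_cases t <;> simp
    have key : ∀ t : Fin 4, (bxor y x) t = false → x t = y t := by
      intro t e1; simp only [bxor] at e1; revert e1; cases x t <;> cases y t <;> decide
    rcases ht with rfl | rfl | rfl | rfl
    · exact key 0 h.1.1.1
    · exact key 1 h.1.1.2
    · exact key 2 h.1.2
    · exact key 3 h.2
  have hδ₁ := hne z₂ z₁ hz₂₁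
  have hδ₂ := hne z₃ z₁ hz₃₁
  have hδ₁₂ : ((((bxor z₁ z₂) 0 ^^ (bxor z₁ z₃) 0) || ((bxor z₁ z₂) 1 ^^ (bxor z₁ z₃) 1) || ((bxor z₁ z₂) 2 ^^ (bxor z₁ z₃) 2) ||
      ((bxor z₁ z₂) 3 ^^ (bxor z₁ z₃) 3))) = true := by
    have e1 := hne z₃ z₂ hz₃₂
    have e2 : ∀ t, ((bxor z₁ z₂) t ^^ (bxor z₁ z₃) t) = (bxor z₂ z₃) t := by
      intro t; simp only [bxor]; cases z₁ t <;> cases z₂ t <;> cases z₃ t <;> rfl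
    rw [e2, e2, e2, e2]; exact e1
  obtain ⟨i, j, -, -, -, -, hdec⟩ := tq0_transversal ((bxor z₁ z₂) 0) ((bxor z₁ z₂) 1) ((bxor z₁ z₂) 2) ((bxor z₁ z₂) 3)
    ((bxor z₁ z₃) 0) ((bxor z₁ z₃) 1) ((bxor z₁ z₃) 2) ((bxor z₁ z₃) 3) hδ₁ hδ₂ hδ₁₂
  have hdec' : ∀ m : Fin 4, ∃ xi xj : Bool,
      ((bxor (bxor (fun l => decide (l = m)) (fun l => xi && decide (l = i))) (fun l => xj && decide (l = j))) = zeroVec ∨ (bxor (bxor (fun l => decide (l = m)) (fun l => xi && decide (l = i))) (fun l => xj && decide (l = j))) = bxor z₁ z₂ ∨ (bxor (bxor (fun l => decide (l = m)) (fun l => xi && decide (l = i))) (fun l => xj && decide (l = j))) = bxor z₁ z₃ ∨ (bxor (bxor (fun l => decide (l = m)) (fun l => xi && decide (l = i))) (fun l => xj && decide (l = j))) = bxor z₂ z₃) := by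
    intro m
    obtain ⟨xi, xj, h⟩ := hdec m
    exact ⟨xi, xj, tq0_inD_of_bool z₁ z₂ z₃ _ (by simp only [bxor]; exact h)⟩
  -- the coset structure `β_v = c_x X ⊕ c_y Y`
  have hP := tq0_coset (fun v j' k' => ((κ (Fin.append (Matrix.vecCons false v) zeroVec) ^^ κ (Fin.append (Matrix.vecCons false v) (fun l => decide (l = k')))) ^^ (κ (Fin.append (Matrix.vecCons false v) (fun l => decide (l = j'))) ^^ κ (Fin.append (Matrix.vecCons false v) (bxor (fun l => decide (l = j')) (fun l => decide (l = k'))))))) (fun j' k' a b c => hA3 j' k' a b c)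
    z₁ z₂ z₃ hAz1 hAz2 hAz3 i j hdec'
  -- at most three cells of `Z₁₀` weigh exactly `64`
  have hT64 : 2 ^ #((univ.filter fun v : Fin 4 → Bool => ((v 0 && v 1) ^^ (v 2 && v 3)) = false).filter fun v => #(univ.filter fun s : Fin 7 → Bool => κ (Fin.append (Matrix.vecCons false v) s) = true) = 64) ≤ 8 := by
    have hsum : (∑ v ∈ univ.filter (fun v : Fin 4 → Bool => ((v 0 && v 1) ^^ (v 2 && v 3)) = false), #(univ.filter fun s : Fin 7 → Bool => κ (Fin.append (Matrix.vecCons false v) s) = true)) ≤ 255 := by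
      rw [tq0_sum_Z10 (fun v => #(univ.filter fun s : Fin 7 → Bool => κ (Fin.append (Matrix.vecCons false v) s) = true))]; exact hbudget
    have hsub := sum_le_sum_of_subset (f := fun v : Fin 4 → Bool => #(univ.filter fun s : Fin 7 → Bool => κ (Fin.append (Matrix.vecCons false v) s) = true))
      (filter_subset (fun v => #(univ.filter fun s : Fin 7 → Bool => κ (Fin.append (Matrix.vecCons false v) s) = true) = 64) (univ.filter fun v : Fin 4 → Bool => ((v 0 && v 1) ^^ (v 2 && v 3)) = false))
    have hconst : (∑ v ∈ (univ.filter fun v : Fin 4 → Bool => ((v 0 && v 1) ^^ (v 2 && v 3)) = false).filter (fun v => #(univ.filter fun s : Fin 7 → Bool => κ (Fin.append (Matrix.vecCons false v) s) = true) = 64), #(univ.filter fun s : Fin 7 → Bool => κ (Fin.append (Matrix.vecCons false v) s) = true)) =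
        64 * #((univ.filter fun v : Fin 4 → Bool => ((v 0 && v 1) ^^ (v 2 && v 3)) = false).filter fun v => #(univ.filter fun s : Fin 7 → Bool => κ (Fin.append (Matrix.vecCons false v) s) = true) = 64) := by
      rw [sum_congr rfl (fun v hv => (mem_filter.mp hv).2), sum_const, smul_eq_mul, mul_comm]
    have h3 : #((univ.filter fun v : Fin 4 → Bool => ((v 0 && v 1) ^^ (v 2 && v 3)) = false).filter fun v => #(univ.filter fun s : Fin 7 → Bool => κ (Fin.append (Matrix.vecCons false v) s) = true) = 64) ≤ 3 := by omega
    calc 2 ^ #((univ.filter fun v : Fin 4 → Bool => ((v 0 && v 1) ^^ (v 2 && v 3)) = false).filter fun v => #(univ.filter fun s : Fin 7 → Bool => κ (Fin.append (Matrix.vecCons false v) s) = true) = 64) ≤ 2 ^ 3 :=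
        Nat.pow_le_pow_right (by norm_num) h3
      _ = 8 := by norm_num
  -- case analysis on `X = β(z₁ ⊕ e_i)`, `Y = β(z₁ ⊕ e_j)`
  by_cases hX0 : ∀ j' k' : Fin 7, ((κ (Fin.append (Matrix.vecCons false (bxor z₁ (fun l => decide (l = i)))) zeroVec) ^^ κ (Fin.append (Matrix.vecCons false (bxor z₁ (fun l => decide (l = i)))) (fun l => decide (l = k')))) ^^ (κ (Fin.append (Matrix.vecCons false (bxor z₁ (fun l => decide (l = i)))) (fun l => decide (l = j'))) ^^ κ (Fin.append (Matrix.vecCons false (bxor z₁ (fun l => decide (l = i)))) (bxor (fun l => decide (l = j')) (fun l => decide (l = k')))))) = false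
  · by_cases hY0 : ∀ j' k' : Fin 7, ((κ (Fin.append (Matrix.vecCons false (bxor z₁ (fun l => decide (l = j)))) zeroVec) ^^ κ (Fin.append (Matrix.vecCons false (bxor z₁ (fun l => decide (l = j)))) (fun l => decide (l = k')))) ^^ (κ (Fin.append (Matrix.vecCons false (bxor z₁ (fun l => decide (l = j)))) (fun l => decide (l = j'))) ^^ κ (Fin.append (Matrix.vecCons false (bxor z₁ (fun l => decide (l = j)))) (bxor (fun l => decide (l = j')) (fun l => decide (l = k')))))) = false
    · -- all forms vanish: every vector is radical for every cell
      have hall : ∀ (v : Fin 4 → Bool) (j' k' : Fin 7), ((κ (Fin.append (Matrix.vecCons false v) zeroVec) ^^ κ (Fin.append (Matrix.vecCons false v) (fun l => decide (l = k')))) ^^ (κ (Fin.append (Matrix.vecCons false v) (fun l => decide (l = j'))) ^^ κ (Fin.append (Matrix.vecCons false v) (bxor (fun l => decide (l = j')) (fun l => decide (l = k')))))) = false := by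
        intro v j' k'
        obtain ⟨cx, cy, hT, -⟩ := hP v
        rw [hT j' k', hX0, hY0]
        cases cx <;> cases cy <;> rfl
      refine tq0_pigeon κ hκ c d hdc hds hd hpair hF hzzz (univ : Finset (Fin 7 → Bool)) (fun u _ v k => ?_)
        (by rw [card_univ, Fintype.card_fun, Fintype.card_bool, Fintype.card_fin]; omega)
      have hr := tq0_form_row_zero (fun s : Fin 7 → Bool => κ (Fin.append (Matrix.vecCons false v) s)) (hq v) (fun l => decide (l = k)) (fun m => hall v k m) u
      rw [bxor_comm] at hr
      revert hr
      cases κ (Fin.append (Matrix.vecCons false v) zeroVec) <;> cases κ (Fin.append (Matrix.vecCons false v) (fun l => decide (l = k))) <;> cases κ (Fin.append (Matrix.vecCons false v) u) <;>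
        cases κ (Fin.append (Matrix.vecCons false v) (bxor u (fun l => decide (l = k)))) <;> decide
    · -- `X = 0`, `Y ≠ 0`: hyperplane case with `Ξ = Y`
      push Not at hY0
      obtain ⟨j₁, k₁, hY1⟩ := hY0
      replace hY1 : ((κ (Fin.append (Matrix.vecCons false (bxor z₁ (fun l => decide (l = j)))) zeroVec) ^^ κ (Fin.append (Matrix.vecCons false (bxor z₁ (fun l => decide (l = j)))) (fun l => decide (l = k₁)))) ^^ (κ (Fin.append (Matrix.vecCons false (bxor z₁ (fun l => decide (l = j)))) (fun l => decide (l = j₁))) ^^ κ (Fin.append (Matrix.vecCons false (bxor z₁ (fun l => decide (l = j)))) (bxor (fun l => decide (l = j₁)) (fun l => decide (l = k₁)))))) = true := by simpa using hY1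
      refine tq0_hyper HLEAF κ hκ c d hcs hcc hcd hds hdc hdd hd hpair hD hF hlt hzzz (((κ zeroVec ^^ κ (bxor zeroVec (fun l => decide (l = Fin.natAdd 5 k₁)))) ^^ (κ (bxor zeroVec (fun l => decide (l = Fin.natAdd 5 j₁))) ^^ κ (bxor (bxor zeroVec (fun l => decide (l = Fin.natAdd 5 j₁))) (fun l => decide (l = Fin.natAdd 5 k₁)))))) ((((κ zeroVec ^^ κ (bxor zeroVec (fun l => decide (l = Fin.natAdd 5 k₁)))) ^^ (κ (bxor zeroVec (fun l => decide (l = Fin.natAdd 5 j₁))) ^^ κ (bxor (bxor zeroVec (fun l => decide (l = Fin.natAdd 5 j₁))) (fun l => decide (l = Fin.natAdd 5 k₁))))) ^^ ((κ (bxor zeroVec (fun l => decide (l = Fin.castAdd 7 (1 : Fin 5)))) ^^ κ (bxor (bxor zeroVec (fun l => decide (l = Fin.castAdd 7 (1 : Fin 5)))) (fun l => decide (l = Fin.natAdd 5 k₁)))) ^^ (κ (bxor (bxor zeroVec (fun l => decide (l = Fin.castAdd 7 (1 : Fin 5)))) (fun l => decide (l = Fin.natAdd 5 j₁))) ^^ κ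 (bxor (bxor (bxor zeroVec (fun l => decide (l = Fin.castAdd 7 (1 : Fin 5)))) (fun l => decide (l = Fin.natAdd 5 j₁))) (fun l => decide (l = Fin.natAdd 5 k₁))))))) ((((κ zeroVec ^^ κ (bxor zeroVec (fun l => decide (l = Fin.natAdd 5 k₁)))) ^^ (κ (bxor zeroVec (fun l => decide (l = Fin.natAdd 5 j₁))) ^^ κ (bxor (bxor zeroVec (fun l => decide (l = Fin.natAdd 5 j₁))) (fun l => decide (l = Fin.natAdd 5 k₁))))) ^^ ((κ (bxor zeroVec (fun l => decide (l = Fin.castAdd 7 (2 : Fin 5)))) ^^ κ (bxor (bxor zeroVec (fun l => decide (l = Fin.castAdd 7 (2 : Fin 5)))) (fun l => decide (l = Fin.natAdd 5 k₁)))) ^^ (κ (bxor (bxor zeroVec (fun l => decide (l = Fin.castAdd 7 (2 : Fin 5)))) (fun l => decide (l = Fin.natAdd 5 j₁))) ^^ κ (bxor (bxor (bxor zeroVec (fun l => decide (l = Fin.castAdd 7 (2 : Fin 5)))) (fun l => decide (l = Fin.natAdd 5 j₁))) (fun l => decide (l = Fin.natAdd 5 k₁))))))) ((((κ zeroVec ^^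 κ (bxor zeroVec (fun l => decide (l = Fin.natAdd 5 k₁)))) ^^ (κ (bxor zeroVec (fun l => decide (l = Fin.natAdd 5 j₁))) ^^ κ (bxor (bxor zeroVec (fun l => decide (l = Fin.natAdd 5 j₁))) (fun l => decide (l = Fin.natAdd 5 k₁))))) ^^ ((κ (bxor zeroVec (fun l => decide (l = Fin.castAdd 7 (3 : Fin 5)))) ^^ κ (bxor (bxor zeroVec (fun l => decide (l = Fin.castAdd 7 (3 : Fin 5)))) (fun l => decide (l = Fin.natAdd 5 k₁)))) ^^ (κ (bxor (bxor zeroVec (fun l => decide (l = Fin.castAdd 7 (3 : Fin 5)))) (fun l => decide (l = Fin.natAdd 5 j₁))) ^^ κ (bxor (bxor (bxor zeroVec (fun l => decide (l = Fin.castAdd 7 (3 : Fin 5)))) (fun l => decide (l = Fin.natAdd 5 j₁))) (fun l => decide (l = Fin.natAdd 5 k₁))))))) ((((κ zeroVec ^^ κ (bxor zeroVec (fun l => decide (l = Fin.natAdd 5 k₁)))) ^^ (κ (bxor zeroVec (fun l => decide (l = Fin.natAdd 5 j₁))) ^^ κ (bxor (bxor zeroVec (fun l => decide (l = Fin.natAdd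 5 j₁))) (fun l => decide (l = Fin.natAdd 5 k₁))))) ^^ ((κ (bxor zeroVec (fun l => decide (l = Fin.castAdd 7 (4 : Fin 5)))) ^^ κ (bxor (bxor zeroVec (fun l => decide (l = Fin.castAdd 7 (4 : Fin 5)))) (fun l => decide (l = Fin.natAdd 5 k₁)))) ^^ (κ (bxor (bxor zeroVec (fun l => decide (l = Fin.castAdd 7 (4 : Fin 5)))) (fun l => decide (l = Fin.natAdd 5 j₁))) ^^ κ (bxor (bxor (bxor zeroVec (fun l => decide (l = Fin.castAdd 7 (4 : Fin 5)))) (fun l => decide (l = Fin.natAdd 5 j₁))) (fun l => decide (l = Fin.natAdd 5 k₁)))))))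
        (tq1_affine_nonconst (((κ zeroVec ^^ κ (bxor zeroVec (fun l => decide (l = Fin.natAdd 5 k₁)))) ^^ (κ (bxor zeroVec (fun l => decide (l = Fin.natAdd 5 j₁))) ^^ κ (bxor (bxor zeroVec (fun l => decide (l = Fin.natAdd 5 j₁))) (fun l => decide (l = Fin.natAdd 5 k₁)))))) ((((κ zeroVec ^^ κ (bxor zeroVec (fun l => decide (l = Fin.natAdd 5 k₁)))) ^^ (κ (bxor zeroVec (fun l => decide (l = Fin.natAdd 5 j₁))) ^^ κ (bxor (bxor zeroVec (fun l => decide (l = Fin.natAdd 5 j₁))) (fun l => decide (l = Fin.natAdd 5 k₁))))) ^^ ((κ (bxor zeroVec (fun l => decide (l = Fin.castAdd 7 (1 : Fin 5)))) ^^ κ (bxor (bxor zeroVec (fun l => decide (l = Fin.castAdd 7 (1 : Fin 5)))) (fun l => decide (l = Fin.natAdd 5 k₁)))) ^^ (κ (bxor (bxor zeroVec (fun l => decide (l = Fin.castAdd 7 (1 : Fin 5)))) (fun l => decide (l = Fin.natAdd 5 j₁))) ^^ κ (bxor (bxor (bxor zeroVec (fun l => decide (l = Fin.castAdd 7 (1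 : Fin 5)))) (fun l => decide (l = Fin.natAdd 5 j₁))) (fun l => decide (l = Fin.natAdd 5 k₁))))))) ((((κ zeroVec ^^ κ (bxor zeroVec (fun l => decide (l = Fin.natAdd 5 k₁)))) ^^ (κ (bxor zeroVec (fun l => decide (l = Fin.natAdd 5 j₁))) ^^ κ (bxor (bxor zeroVec (fun l => decide (l = Fin.natAdd 5 j₁))) (fun l => decide (l = Fin.natAdd 5 k₁))))) ^^ ((κ (bxor zeroVec (fun l => decide (l = Fin.castAdd 7 (2 : Fin 5)))) ^^ κ (bxor (bxor zeroVec (fun l => decide (l = Fin.castAdd 7 (2 : Fin 5)))) (fun l => decide (l = Fin.natAdd 5 k₁)))) ^^ (κ (bxor (bxor zeroVec (fun l => decide (l = Fin.castAdd 7 (2 : Fin 5)))) (fun l => decide (l = Fin.natAdd 5 j₁))) ^^ κ (bxor (bxor (bxor zeroVec (fun l => decide (l = Fin.castAdd 7 (2 : Fin 5)))) (fun l => decide (l = Fin.natAdd 5 j₁))) (fun l => decide (l = Fin.natAdd 5 k₁))))))) ((((κ zeroVec ^^ κ (bxor zeroVec (fun l => decide (l = Fin.natAdd 5 k₁)))) ^^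 (κ (bxor zeroVec (fun l => decide (l = Fin.natAdd 5 j₁))) ^^ κ (bxor (bxor zeroVec (fun l => decide (l = Fin.natAdd 5 j₁))) (fun l => decide (l = Fin.natAdd 5 k₁))))) ^^ ((κ (bxor zeroVec (fun l => decide (l = Fin.castAdd 7 (3 : Fin 5)))) ^^ κ (bxor (bxor zeroVec (fun l => decide (l = Fin.castAdd 7 (3 : Fin 5)))) (fun l => decide (l = Fin.natAdd 5 k₁)))) ^^ (κ (bxor (bxor zeroVec (fun l => decide (l = Fin.castAdd 7 (3 : Fin 5)))) (fun l => decide (l = Fin.natAdd 5 j₁))) ^^ κ (bxor (bxor (bxor zeroVec (fun l => decide (l = Fin.castAdd 7 (3 : Fin 5)))) (fun l => decide (l = Fin.natAdd 5 j₁))) (fun l => decide (l = Fin.natAdd 5 k₁))))))) ((((κ zeroVec ^^ κ (bxor zeroVec (fun l => decide (l = Fin.natAdd 5 k₁)))) ^^ (κ (bxor zeroVec (fun l => decide (l = Fin.natAdd 5 j₁))) ^^ κ (bxor (bxor zeroVec (fun l => decide (l = Fin.natAdd 5 j₁))) (fun l => decide (l = Fin.natAdd 5 k₁))))) ^^ ((κ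 (bxor zeroVec (fun l => decide (l = Fin.castAdd 7 (4 : Fin 5)))) ^^ κ (bxor (bxor zeroVec (fun l => decide (l = Fin.castAdd 7 (4 : Fin 5)))) (fun l => decide (l = Fin.natAdd 5 k₁)))) ^^ (κ (bxor (bxor zeroVec (fun l => decide (l = Fin.castAdd 7 (4 : Fin 5)))) (fun l => decide (l = Fin.natAdd 5 j₁))) ^^ κ (bxor (bxor (bxor zeroVec (fun l => decide (l = Fin.castAdd 7 (4 : Fin 5)))) (fun l => decide (l = Fin.natAdd 5 j₁))) (fun l => decide (l = Fin.natAdd 5 k₁))))))) (bxor z₁ (fun l => decide (l = j))) z₁ (by rw [← haffine]; exact hY1) (by rw [← haffine]; exact hAz1 j₁ k₁))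
        (fun j' k' => ((κ (Fin.append (Matrix.vecCons false (bxor z₁ (fun l => decide (l = j)))) zeroVec) ^^ κ (Fin.append (Matrix.vecCons false (bxor z₁ (fun l => decide (l = j)))) (fun l => decide (l = k')))) ^^ (κ (Fin.append (Matrix.vecCons false (bxor z₁ (fun l => decide (l = j)))) (fun l => decide (l = j'))) ^^ κ (Fin.append (Matrix.vecCons false (bxor z₁ (fun l => decide (l = j)))) (bxor (fun l => decide (l = j')) (fun l => decide (l = k'))))))) j₁ k₁ hY1 (bxor z₁ (fun l => decide (l = j))) (by rw [← haffine]; exact hY1) (fun v j' k' => ?_)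
      obtain ⟨cx, cy, hT, -⟩ := hP v
      rw [← haffine j₁ k₁ v, hT j' k', hT j₁ k₁, hX0, hX0, hY1]
      cases cx <;> cases cy <;> cases ((κ (Fin.append (Matrix.vecCons false (bxor z₁ (fun l => decide (l = j)))) zeroVec) ^^ κ (Fin.append (Matrix.vecCons false (bxor z₁ (fun l => decide (l = j)))) (fun l => decide (l = k')))) ^^ (κ (Fin.append (Matrix.vecCons false (bxor z₁ (fun l => decide (l = j)))) (fun l => decide (l = j'))) ^^ κ (Fin.append (Matrix.vecCons false (bxor z₁ (fun l => decide (l = j)))) (bxor (fun l => decide (l = j')) (fun l => decide (l = k')))))) <;> rfl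
  · push Not at hX0
    obtain ⟨j₁, k₁, hX1⟩ := hX0
    replace hX1 : ((κ (Fin.append (Matrix.vecCons false (bxor z₁ (fun l => decide (l = i)))) zeroVec) ^^ κ (Fin.append (Matrix.vecCons false (bxor z₁ (fun l => decide (l = i)))) (fun l => decide (l = k₁)))) ^^ (κ (Fin.append (Matrix.vecCons false (bxor z₁ (fun l => decide (l = i)))) (fun l => decide (l = j₁))) ^^ κ (Fin.append (Matrix.vecCons false (bxor z₁ (fun l => decide (l = i)))) (bxor (fun l => decide (l = j₁)) (fun l => decide (l = k₁)))))) = true := by simpa using hX1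
    by_cases hY0 : ∀ j' k' : Fin 7, ((κ (Fin.append (Matrix.vecCons false (bxor z₁ (fun l => decide (l = j)))) zeroVec) ^^ κ (Fin.append (Matrix.vecCons false (bxor z₁ (fun l => decide (l = j)))) (fun l => decide (l = k')))) ^^ (κ (Fin.append (Matrix.vecCons false (bxor z₁ (fun l => decide (l = j)))) (fun l => decide (l = j'))) ^^ κ (Fin.append (Matrix.vecCons false (bxor z₁ (fun l => decide (l = j)))) (bxor (fun l => decide (l = j')) (fun l => decide (l = k')))))) = false
    · -- `X ≠ 0`, `Y = 0`: hyperplane case with `Ξ = X`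
      refine tq0_hyper HLEAF κ hκ c d hcs hcc hcd hds hdc hdd hd hpair hD hF hlt hzzz (((κ zeroVec ^^ κ (bxor zeroVec (fun l => decide (l = Fin.natAdd 5 k₁)))) ^^ (κ (bxor zeroVec (fun l => decide (l = Fin.natAdd 5 j₁))) ^^ κ (bxor (bxor zeroVec (fun l => decide (l = Fin.natAdd 5 j₁))) (fun l => decide (l = Fin.natAdd 5 k₁)))))) ((((κ zeroVec ^^ κ (bxor zeroVec (fun l => decide (l = Fin.natAdd 5 k₁)))) ^^ (κ (bxor zeroVec (fun l => decide (l = Fin.natAdd 5 j₁))) ^^ κ (bxor (bxor zeroVec (fun l => decide (l = Fin.natAdd 5 j₁))) (fun l => decide (l = Fin.natAdd 5 k₁))))) ^^ ((κ (bxor zeroVec (fun l => decide (l = Fin.castAdd 7 (1 : Fin 5)))) ^^ κ (bxor (bxor zeroVec (fun l => decide (l = Fin.castAdd 7 (1 : Fin 5)))) (fun l => decide (l = Fin.natAdd 5 k₁)))) ^^ (κ (bxor (bxor zeroVec (fun l => decide (l = Fin.castAdd 7 (1 : Fin 5)))) (fun l => decide (l = Fin.natAdd 5 j₁))) ^^ κ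 (bxor (bxor (bxor zeroVec (fun l => decide (l = Fin.castAdd 7 (1 : Fin 5)))) (fun l => decide (l = Fin.natAdd 5 j₁))) (fun l => decide (l = Fin.natAdd 5 k₁))))))) ((((κ zeroVec ^^ κ (bxor zeroVec (fun l => decide (l = Fin.natAdd 5 k₁)))) ^^ (κ (bxor zeroVec (fun l => decide (l = Fin.natAdd 5 j₁))) ^^ κ (bxor (bxor zeroVec (fun l => decide (l = Fin.natAdd 5 j₁))) (fun l => decide (l = Fin.natAdd 5 k₁))))) ^^ ((κ (bxor zeroVec (fun l => decide (l = Fin.castAdd 7 (2 : Fin 5)))) ^^ κ (bxor (bxor zeroVec (fun l => decide (l = Fin.castAdd 7 (2 : Fin 5)))) (fun l => decide (l = Fin.natAdd 5 k₁)))) ^^ (κ (bxor (bxor zeroVec (fun l => decide (l = Fin.castAdd 7 (2 : Fin 5)))) (fun l => decide (l = Fin.natAdd 5 j₁))) ^^ κ (bxor (bxor (bxor zeroVec (fun l => decide (l = Fin.castAdd 7 (2 : Fin 5)))) (fun l => decide (l = Fin.natAdd 5 j₁))) (fun l => decide (l = Fin.natAdd 5 k₁))))))) ((((κ zeroVec ^^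 κ (bxor zeroVec (fun l => decide (l = Fin.natAdd 5 k₁)))) ^^ (κ (bxor zeroVec (fun l => decide (l = Fin.natAdd 5 j₁))) ^^ κ (bxor (bxor zeroVec (fun l => decide (l = Fin.natAdd 5 j₁))) (fun l => decide (l = Fin.natAdd 5 k₁))))) ^^ ((κ (bxor zeroVec (fun l => decide (l = Fin.castAdd 7 (3 : Fin 5)))) ^^ κ (bxor (bxor zeroVec (fun l => decide (l = Fin.castAdd 7 (3 : Fin 5)))) (fun l => decide (l = Fin.natAdd 5 k₁)))) ^^ (κ (bxor (bxor zeroVec (fun l => decide (l = Fin.castAdd 7 (3 : Fin 5)))) (fun l => decide (l = Fin.natAdd 5 j₁))) ^^ κ (bxor (bxor (bxor zeroVec (fun l => decide (l = Fin.castAdd 7 (3 : Fin 5)))) (fun l => decide (l = Fin.natAdd 5 j₁))) (fun l => decide (l = Fin.natAdd 5 k₁))))))) ((((κ zeroVec ^^ κ (bxor zeroVec (fun l => decide (l = Fin.natAdd 5 k₁)))) ^^ (κ (bxor zeroVec (fun l => decide (l = Fin.natAdd 5 j₁))) ^^ κ (bxor (bxor zeroVec (fun l => decide (l = Fin.natAdd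 5 j₁))) (fun l => decide (l = Fin.natAdd 5 k₁))))) ^^ ((κ (bxor zeroVec (fun l => decide (l = Fin.castAdd 7 (4 : Fin 5)))) ^^ κ (bxor (bxor zeroVec (fun l => decide (l = Fin.castAdd 7 (4 : Fin 5)))) (fun l => decide (l = Fin.natAdd 5 k₁)))) ^^ (κ (bxor (bxor zeroVec (fun l => decide (l = Fin.castAdd 7 (4 : Fin 5)))) (fun l => decide (l = Fin.natAdd 5 j₁))) ^^ κ (bxor (bxor (bxor zeroVec (fun l => decide (l = Fin.castAdd 7 (4 : Fin 5)))) (fun l => decide (l = Fin.natAdd 5 j₁))) (fun l => decide (l = Fin.natAdd 5 k₁)))))))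
        (tq1_affine_nonconst (((κ zeroVec ^^ κ (bxor zeroVec (fun l => decide (l = Fin.natAdd 5 k₁)))) ^^ (κ (bxor zeroVec (fun l => decide (l = Fin.natAdd 5 j₁))) ^^ κ (bxor (bxor zeroVec (fun l => decide (l = Fin.natAdd 5 j₁))) (fun l => decide (l = Fin.natAdd 5 k₁)))))) ((((κ zeroVec ^^ κ (bxor zeroVec (fun l => decide (l = Fin.natAdd 5 k₁)))) ^^ (κ (bxor zeroVec (fun l => decide (l = Fin.natAdd 5 j₁))) ^^ κ (bxor (bxor zeroVec (fun l => decide (l = Fin.natAdd 5 j₁))) (fun l => decide (l = Fin.natAdd 5 k₁))))) ^^ ((κ (bxor zeroVec (fun l => decide (l = Fin.castAdd 7 (1 : Fin 5)))) ^^ κ (bxor (bxor zeroVec (fun l => decide (l = Fin.castAdd 7 (1 : Fin 5)))) (fun l => decide (l = Fin.natAdd 5 k₁)))) ^^ (κ (bxor (bxor zeroVec (fun l => decide (l = Fin.castAdd 7 (1 : Fin 5)))) (fun l => decide (l = Fin.natAdd 5 j₁))) ^^ κ (bxor (bxor (bxor zeroVec (fun l => decide (l = Fin.castAdd 7 (1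 : Fin 5)))) (fun l => decide (l = Fin.natAdd 5 j₁))) (fun l => decide (l = Fin.natAdd 5 k₁))))))) ((((κ zeroVec ^^ κ (bxor zeroVec (fun l => decide (l = Fin.natAdd 5 k₁)))) ^^ (κ (bxor zeroVec (fun l => decide (l = Fin.natAdd 5 j₁))) ^^ κ (bxor (bxor zeroVec (fun l => decide (l = Fin.natAdd 5 j₁))) (fun l => decide (l = Fin.natAdd 5 k₁))))) ^^ ((κ (bxor zeroVec (fun l => decide (l = Fin.castAdd 7 (2 : Fin 5)))) ^^ κ (bxor (bxor zeroVec (fun l => decide (l = Fin.castAdd 7 (2 : Fin 5)))) (fun l => decide (l = Fin.natAdd 5 k₁)))) ^^ (κ (bxor (bxor zeroVec (fun l => decide (l = Fin.castAdd 7 (2 : Fin 5)))) (fun l => decide (l = Fin.natAdd 5 j₁))) ^^ κ (bxor (bxor (bxor zeroVec (fun l => decide (l = Fin.castAdd 7 (2 : Fin 5)))) (fun l => decide (l = Fin.natAdd 5 j₁))) (fun l => decide (l = Fin.natAdd 5 k₁))))))) ((((κ zeroVec ^^ κ (bxor zeroVec (fun l => decide (l = Fin.natAdd 5 k₁)))) ^^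 (κ (bxor zeroVec (fun l => decide (l = Fin.natAdd 5 j₁))) ^^ κ (bxor (bxor zeroVec (fun l => decide (l = Fin.natAdd 5 j₁))) (fun l => decide (l = Fin.natAdd 5 k₁))))) ^^ ((κ (bxor zeroVec (fun l => decide (l = Fin.castAdd 7 (3 : Fin 5)))) ^^ κ (bxor (bxor zeroVec (fun l => decide (l = Fin.castAdd 7 (3 : Fin 5)))) (fun l => decide (l = Fin.natAdd 5 k₁)))) ^^ (κ (bxor (bxor zeroVec (fun l => decide (l = Fin.castAdd 7 (3 : Fin 5)))) (fun l => decide (l = Fin.natAdd 5 j₁))) ^^ κ (bxor (bxor (bxor zeroVec (fun l => decide (l = Fin.castAdd 7 (3 : Fin 5)))) (fun l => decide (l = Fin.natAdd 5 j₁))) (fun l => decide (l = Fin.natAdd 5 k₁))))))) ((((κ zeroVec ^^ κ (bxor zeroVec (fun l => decide (l = Fin.natAdd 5 k₁)))) ^^ (κ (bxor zeroVec (fun l => decide (l = Fin.natAdd 5 j₁))) ^^ κ (bxor (bxor zeroVec (fun l => decide (l = Fin.natAdd 5 j₁))) (fun l => decide (l = Fin.natAdd 5 k₁))))) ^^ ((κ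 (bxor zeroVec (fun l => decide (l = Fin.castAdd 7 (4 : Fin 5)))) ^^ κ (bxor (bxor zeroVec (fun l => decide (l = Fin.castAdd 7 (4 : Fin 5)))) (fun l => decide (l = Fin.natAdd 5 k₁)))) ^^ (κ (bxor (bxor zeroVec (fun l => decide (l = Fin.castAdd 7 (4 : Fin 5)))) (fun l => decide (l = Fin.natAdd 5 j₁))) ^^ κ (bxor (bxor (bxor zeroVec (fun l => decide (l = Fin.castAdd 7 (4 : Fin 5)))) (fun l => decide (l = Fin.natAdd 5 j₁))) (fun l => decide (l = Fin.natAdd 5 k₁))))))) (bxor z₁ (fun l => decide (l = i))) z₁ (by rw [← haffine]; exact hX1) (by rw [← haffine]; exact hAz1 j₁ k₁))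
        (fun j' k' => ((κ (Fin.append (Matrix.vecCons false (bxor z₁ (fun l => decide (l = i)))) zeroVec) ^^ κ (Fin.append (Matrix.vecCons false (bxor z₁ (fun l => decide (l = i)))) (fun l => decide (l = k')))) ^^ (κ (Fin.append (Matrix.vecCons false (bxor z₁ (fun l => decide (l = i)))) (fun l => decide (l = j'))) ^^ κ (Fin.append (Matrix.vecCons false (bxor z₁ (fun l => decide (l = i)))) (bxor (fun l => decide (l = j')) (fun l => decide (l = k'))))))) j₁ k₁ hX1 (bxor z₁ (fun l => decide (l = i))) (by rw [← haffine]; exact hX1) (fun v j' k' => ?_)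
      obtain ⟨cx, cy, hT, -⟩ := hP v
      rw [← haffine j₁ k₁ v, hT j' k', hT j₁ k₁, hY0, hY0, hX1]
      cases cx <;> cases cy <;> cases ((κ (Fin.append (Matrix.vecCons false (bxor z₁ (fun l => decide (l = i)))) zeroVec) ^^ κ (Fin.append (Matrix.vecCons false (bxor z₁ (fun l => decide (l = i)))) (fun l => decide (l = k')))) ^^ (κ (Fin.append (Matrix.vecCons false (bxor z₁ (fun l => decide (l = i)))) (fun l => decide (l = j'))) ^^ κ (Fin.append (Matrix.vecCons false (bxor z₁ (fun l => decide (l = i)))) (bxor (fun l => decide (l = j')) (fun l => decide (l = k')))))) <;> rfl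
    · push Not at hY0
      obtain ⟨j₂, k₂, hY1⟩ := hY0
      replace hY1 : ((κ (Fin.append (Matrix.vecCons false (bxor z₁ (fun l => decide (l = j)))) zeroVec) ^^ κ (Fin.append (Matrix.vecCons false (bxor z₁ (fun l => decide (l = j)))) (fun l => decide (l = k₂)))) ^^ (κ (Fin.append (Matrix.vecCons false (bxor z₁ (fun l => decide (l = j)))) (fun l => decide (l = j₂))) ^^ κ (Fin.append (Matrix.vecCons false (bxor z₁ (fun l => decide (l = j)))) (bxor (fun l => decide (l = j₂)) (fun l => decide (l = k₂)))))) = true := by simpa using hY1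
      by_cases hXY : ∀ j' k' : Fin 7, ((κ (Fin.append (Matrix.vecCons false (bxor z₁ (fun l => decide (l = i)))) zeroVec) ^^ κ (Fin.append (Matrix.vecCons false (bxor z₁ (fun l => decide (l = i)))) (fun l => decide (l = k')))) ^^ (κ (Fin.append (Matrix.vecCons false (bxor z₁ (fun l => decide (l = i)))) (fun l => decide (l = j'))) ^^ κ (Fin.append (Matrix.vecCons false (bxor z₁ (fun l => decide (l = i)))) (bxor (fun l => decide (l = j')) (fun l => decide (l = k')))))) = ((κ (Fin.append (Matrix.vecCons false (bxor z₁ (fun l => decide (l = j)))) zeroVec) ^^ κ (Fin.append (Matrix.vecCons false (bxor z₁ (fun l => decide (l = j)))) (fun l => decide (l = k')))) ^^ (κ (Fin.append (Matrix.vecCons false (bxor z₁ (fun l => decide (l = j)))) (fun l => decide (l = j'))) ^^ κ (Fin.append (Matrix.vecCons false (bxor z₁ (fun l => decide (l = j)))) (bxor (fun l => decide (l = j')) (fun l => decide (l = k'))))))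
      · -- `X = Y ≠ 0`: hyperplane case with `Ξ = X`, `α = c_x ⊕ c_y`
        refine tq0_hyper HLEAF κ hκ c d hcs hcc hcd hds hdc hdd hd hpair hD hF hlt hzzz (((κ zeroVec ^^ κ (bxor zeroVec (fun l => decide (l = Fin.natAdd 5 k₁)))) ^^ (κ (bxor zeroVec (fun l => decide (l = Fin.natAdd 5 j₁))) ^^ κ (bxor (bxor zeroVec (fun l => decide (l = Fin.natAdd 5 j₁))) (fun l => decide (l = Fin.natAdd 5 k₁)))))) ((((κ zeroVec ^^ κ (bxor zeroVec (fun l => decide (l = Fin.natAdd 5 k₁)))) ^^ (κ (bxor zeroVec (fun l => decide (l = Fin.natAdd 5 j₁))) ^^ κ (bxor (bxor zeroVec (fun l => decide (l = Fin.natAdd 5 j₁))) (fun l => decide (l = Fin.natAdd 5 k₁))))) ^^ ((κ (bxor zeroVec (fun l => decide (l = Fin.castAdd 7 (1 : Fin 5)))) ^^ κ (bxor (bxor zeroVec (fun l => decide (l = Fin.castAdd 7 (1 : Fin 5)))) (fun l => decide (l = Fin.natAdd 5 k₁)))) ^^ (κ (bxor (bxor zeroVec (fun l => decide (l = Fin.castAdd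 7 (1 : Fin 5)))) (fun l => decide (l = Fin.natAdd 5 j₁))) ^^ κ (bxor (bxor (bxor zeroVec (fun l => decide (l = Fin.castAdd 7 (1 : Fin 5)))) (fun l => decide (l = Fin.natAdd 5 j₁))) (fun l => decide (l = Fin.natAdd 5 k₁))))))) ((((κ zeroVec ^^ κ (bxor zeroVec (fun l => decide (l = Fin.natAdd 5 k₁)))) ^^ (κ (bxor zeroVec (fun l => decide (l = Fin.natAdd 5 j₁))) ^^ κ (bxor (bxor zeroVec (fun l => decide (l = Fin.natAdd 5 j₁))) (fun l => decide (l = Fin.natAdd 5 k₁))))) ^^ ((κ (bxor zeroVec (fun l => decide (l = Fin.castAdd 7 (2 : Fin 5)))) ^^ κ (bxor (bxor zeroVec (fun l => decide (l = Fin.castAdd 7 (2 : Fin 5)))) (fun l => decide (l = Fin.natAdd 5 k₁)))) ^^ (κ (bxor (bxor zeroVec (fun l => decide (l = Fin.castAdd 7 (2 : Fin 5)))) (fun l => decide (l = Fin.natAdd 5 j₁))) ^^ κ (bxor (bxor (bxor zeroVec (fun l => decide (l = Fin.castAdd 7 (2 : Fin 5)))) (fun l => decide (l = Fin.natAdd 5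 j₁))) (fun l => decide (l = Fin.natAdd 5 k₁))))))) ((((κ zeroVec ^^ κ (bxor zeroVec (fun l => decide (l = Fin.natAdd 5 k₁)))) ^^ (κ (bxor zeroVec (fun l => decide (l = Fin.natAdd 5 j₁))) ^^ κ (bxor (bxor zeroVec (fun l => decide (l = Fin.natAdd 5 j₁))) (fun l => decide (l = Fin.natAdd 5 k₁))))) ^^ ((κ (bxor zeroVec (fun l => decide (l = Fin.castAdd 7 (3 : Fin 5)))) ^^ κ (bxor (bxor zeroVec (fun l => decide (l = Fin.castAdd 7 (3 : Fin 5)))) (fun l => decide (l = Fin.natAdd 5 k₁)))) ^^ (κ (bxor (bxor zeroVec (fun l => decide (l = Fin.castAdd 7 (3 : Fin 5)))) (fun l => decide (l = Fin.natAdd 5 j₁))) ^^ κ (bxor (bxor (bxor zeroVec (fun l => decide (l = Fin.castAdd 7 (3 : Fin 5)))) (fun l => decide (l = Fin.natAdd 5 j₁))) (fun l => decide (l = Fin.natAdd 5 k₁))))))) ((((κ zeroVec ^^ κ (bxor zeroVec (fun l => decide (l = Fin.natAdd 5 k₁)))) ^^ (κ (bxor zeroVec (fun l => decide (l = Fin.natAdd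 5 j₁))) ^^ κ (bxor (bxor zeroVec (fun l => decide (l = Fin.natAdd 5 j₁))) (fun l => decide (l = Fin.natAdd 5 k₁))))) ^^ ((κ (bxor zeroVec (fun l => decide (l = Fin.castAdd 7 (4 : Fin 5)))) ^^ κ (bxor (bxor zeroVec (fun l => decide (l = Fin.castAdd 7 (4 : Fin 5)))) (fun l => decide (l = Fin.natAdd 5 k₁)))) ^^ (κ (bxor (bxor zeroVec (fun l => decide (l = Fin.castAdd 7 (4 : Fin 5)))) (fun l => decide (l = Fin.natAdd 5 j₁))) ^^ κ (bxor (bxor (bxor zeroVec (fun l => decide (l = Fin.castAdd 7 (4 : Fin 5)))) (fun l => decide (l = Fin.natAdd 5 j₁))) (fun l => decide (l = Fin.natAdd 5 k₁)))))))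
          (tq1_affine_nonconst (((κ zeroVec ^^ κ (bxor zeroVec (fun l => decide (l = Fin.natAdd 5 k₁)))) ^^ (κ (bxor zeroVec (fun l => decide (l = Fin.natAdd 5 j₁))) ^^ κ (bxor (bxor zeroVec (fun l => decide (l = Fin.natAdd 5 j₁))) (fun l => decide (l = Fin.natAdd 5 k₁)))))) ((((κ zeroVec ^^ κ (bxor zeroVec (fun l => decide (l = Fin.natAdd 5 k₁)))) ^^ (κ (bxor zeroVec (fun l => decide (l = Fin.natAdd 5 j₁))) ^^ κ (bxor (bxor zeroVec (fun l => decide (l = Fin.natAdd 5 j₁))) (fun l => decide (l = Fin.natAdd 5 k₁))))) ^^ ((κ (bxor zeroVec (fun l => decide (l = Fin.castAdd 7 (1 : Fin 5)))) ^^ κ (bxor (bxor zeroVec (fun l => decide (l = Fin.castAdd 7 (1 : Fin 5)))) (fun l => decide (l = Fin.natAdd 5 k₁)))) ^^ (κ (bxor (bxor zeroVec (fun l => decide (l = Fin.castAdd 7 (1 : Fin 5)))) (fun l => decide (l = Fin.natAdd 5 j₁))) ^^ κ (bxor (bxor (bxor zeroVec (fun l => decide (l = Fin.castAdd 7 (1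 : Fin 5)))) (fun l => decide (l = Fin.natAdd 5 j₁))) (fun l => decide (l = Fin.natAdd 5 k₁))))))) ((((κ zeroVec ^^ κ (bxor zeroVec (fun l => decide (l = Fin.natAdd 5 k₁)))) ^^ (κ (bxor zeroVec (fun l => decide (l = Fin.natAdd 5 j₁))) ^^ κ (bxor (bxor zeroVec (fun l => decide (l = Fin.natAdd 5 j₁))) (fun l => decide (l = Fin.natAdd 5 k₁))))) ^^ ((κ (bxor zeroVec (fun l => decide (l = Fin.castAdd 7 (2 : Fin 5)))) ^^ κ (bxor (bxor zeroVec (fun l => decide (l = Fin.castAdd 7 (2 : Fin 5)))) (fun l => decide (l = Fin.natAdd 5 k₁)))) ^^ (κ (bxor (bxor zeroVec (fun l => decide (l = Fin.castAdd 7 (2 : Fin 5)))) (fun l => decide (l = Fin.natAdd 5 j₁))) ^^ κ (bxor (bxor (bxor zeroVec (fun l => decide (l = Fin.castAdd 7 (2 : Fin 5)))) (fun l => decide (l = Fin.natAdd 5 j₁))) (fun l => decide (l = Fin.natAdd 5 k₁))))))) ((((κ zeroVec ^^ κ (bxor zeroVec (fun l => decide (l = Fin.natAdd 5 k₁)))) ^^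 (κ (bxor zeroVec (fun l => decide (l = Fin.natAdd 5 j₁))) ^^ κ (bxor (bxor zeroVec (fun l => decide (l = Fin.natAdd 5 j₁))) (fun l => decide (l = Fin.natAdd 5 k₁))))) ^^ ((κ (bxor zeroVec (fun l => decide (l = Fin.castAdd 7 (3 : Fin 5)))) ^^ κ (bxor (bxor zeroVec (fun l => decide (l = Fin.castAdd 7 (3 : Fin 5)))) (fun l => decide (l = Fin.natAdd 5 k₁)))) ^^ (κ (bxor (bxor zeroVec (fun l => decide (l = Fin.castAdd 7 (3 : Fin 5)))) (fun l => decide (l = Fin.natAdd 5 j₁))) ^^ κ (bxor (bxor (bxor zeroVec (fun l => decide (l = Fin.castAdd 7 (3 : Fin 5)))) (fun l => decide (l = Fin.natAdd 5 j₁))) (fun l => decide (l = Fin.natAdd 5 k₁))))))) ((((κ zeroVec ^^ κ (bxor zeroVec (fun l => decide (l = Fin.natAdd 5 k₁)))) ^^ (κ (bxor zeroVec (fun l => decide (l = Fin.natAdd 5 j₁))) ^^ κ (bxor (bxor zeroVec (fun l => decide (l = Fin.natAdd 5 j₁))) (fun l => decide (l = Fin.natAdd 5 k₁))))) ^^ ((κ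 (bxor zeroVec (fun l => decide (l = Fin.castAdd 7 (4 : Fin 5)))) ^^ κ (bxor (bxor zeroVec (fun l => decide (l = Fin.castAdd 7 (4 : Fin 5)))) (fun l => decide (l = Fin.natAdd 5 k₁)))) ^^ (κ (bxor (bxor zeroVec (fun l => decide (l = Fin.castAdd 7 (4 : Fin 5)))) (fun l => decide (l = Fin.natAdd 5 j₁))) ^^ κ (bxor (bxor (bxor zeroVec (fun l => decide (l = Fin.castAdd 7 (4 : Fin 5)))) (fun l => decide (l = Fin.natAdd 5 j₁))) (fun l => decide (l = Fin.natAdd 5 k₁))))))) (bxor z₁ (fun l => decide (l = i))) z₁ (by rw [← haffine]; exact hX1) (by rw [← haffine]; exact hAz1 j₁ k₁))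
          (fun j' k' => ((κ (Fin.append (Matrix.vecCons false (bxor z₁ (fun l => decide (l = i)))) zeroVec) ^^ κ (Fin.append (Matrix.vecCons false (bxor z₁ (fun l => decide (l = i)))) (fun l => decide (l = k')))) ^^ (κ (Fin.append (Matrix.vecCons false (bxor z₁ (fun l => decide (l = i)))) (fun l => decide (l = j'))) ^^ κ (Fin.append (Matrix.vecCons false (bxor z₁ (fun l => decide (l = i)))) (bxor (fun l => decide (l = j')) (fun l => decide (l = k'))))))) j₁ k₁ hX1 (bxor z₁ (fun l => decide (l = i))) (by rw [← haffine]; exact hX1) (fun v j' k' => ?_)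
        obtain ⟨cx, cy, hT, -⟩ := hP v
        rw [← haffine j₁ k₁ v, hT j' k', hT j₁ k₁, ← hXY j' k', ← hXY j₁ k₁, hX1]
        cases cx <;> cases cy <;> cases ((κ (Fin.append (Matrix.vecCons false (bxor z₁ (fun l => decide (l = i)))) zeroVec) ^^ κ (Fin.append (Matrix.vecCons false (bxor z₁ (fun l => decide (l = i)))) (fun l => decide (l = k')))) ^^ (κ (Fin.append (Matrix.vecCons false (bxor z₁ (fun l => decide (l = i)))) (fun l => decide (l = j'))) ^^ κ (Fin.append (Matrix.vecCons false (bxor z₁ (fun l => decide (l = i)))) (bxor (fun l => decide (l = j')) (fun l => decide (l = k')))))) <;> rfl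
      · -- two-flat case
        push Not at hXY
        obtain ⟨jd, kd, hd'⟩ := hXY
        exact tq0_flat κ hκ c d hdc hds hd hpair hD hF hlt hzzz z₁ z₂ z₃ i j hP ⟨j₁, k₁, hX1⟩ ⟨j₂, k₂, hY1⟩ ⟨jd, kd, hd'⟩

/-- **Descendant `0` of the R4 dispatch (`t̄₇ = 0`) is impossible** — literally hypothesis `HZ` of `tpw_HR4_of_branches`
(…CubicFormR4PartnerAssembly): the reduction `tpw_R4_zero_of_leaf` fed with the leaf `tq0_leaf` (…CubicFormR4ZLeaf). [this work] -/
theorem tpw_R4_zero :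
    ∀ (κ : (Fin (5 + 7) → Bool) → Bool), IsDegLeFun 3 κ →
    ∀ (c d : Fin (5 + 7) → Fin (5 + 7) → Fin (5 + 7) → ZMod 2),
    (∀ p j k, c p k j = c p j k) → (∀ p j k, c j p k = c p j k) → (∀ p j, c p j j = 0) →
    (∀ φ j k, d φ k j = d φ j k) → (∀ φ j k, d j φ k = d φ j k) → (∀ φ j, d φ j j = 0) →
    (∀ φ j k, d φ j k =
      if ((((κ zeroVec ^^ κ (bxor zeroVec (fun l => decide (l = k)))) ^^
              (κ (bxor zeroVec (fun l => decide (l = j))) ^^ κ (bxor (bxor zeroVec (fun l => decide (l = j))) (fun l => decide (l = k))))) ^^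
            ((κ (bxor zeroVec (fun l => decide (l = φ))) ^^ κ (bxor (bxor zeroVec (fun l => decide (l = φ))) (fun l => decide (l = k)))) ^^
              (κ (bxor (bxor zeroVec (fun l => decide (l = φ))) (fun l => decide (l = j))) ^^
                κ (bxor (bxor (bxor zeroVec (fun l => decide (l = φ))) (fun l => decide (l = j))) (fun l => decide (l = k))))))) = true
      then 1 else 0) →
    (∀ p φ, (∑ j, ∑ k, (if j < k then c p j k * d φ j k else 0)) = if p = φ then 1 else 0) →
    (∀ y, (κ y ^^ κ (bxor y (fun l => decide (l = Fin.castAdd 7 (0 : Fin 5))))) =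
      ((y (Fin.castAdd 7 (1 : Fin 5)) && y (Fin.castAdd 7 (2 : Fin 5))) ^^ (y (Fin.castAdd 7 (3 : Fin 5)) && y (Fin.castAdd 7 (4 : Fin 5))))) →
    (∀ j k, d (Fin.castAdd 7 (0 : Fin 5)) j k =
      (if (j = Fin.castAdd 7 (1 : Fin 5) ∧ k = Fin.castAdd 7 (2 : Fin 5)) ∨ (j = Fin.castAdd 7 (2 : Fin 5) ∧ k = Fin.castAdd 7 (1 : Fin 5)) then 1 else 0) +
      (if (j = Fin.castAdd 7 (3 : Fin 5) ∧ k = Fin.castAdd 7 (4 : Fin 5)) ∨ (j = Fin.castAdd 7 (4 : Fin 5) ∧ k = Fin.castAdd 7 (3 : Fin 5)) then 1 else 0)) →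
    #(univ.filter fun y : Fin (5 + 7) → Bool => κ y = true) < 1280 →
    (∀ σ τ υ : Fin 7, d (Fin.natAdd 5 σ) (Fin.natAdd 5 τ) (Fin.natAdd 5 υ) = 0) → False :=
  tpw_R4_zero_of_leaf tq0_leaf

end Summit.QuantumAdvantage.QuantumAdvantage.Theorems.CubicForrelation.NearExactIsExact
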